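import Mathlib
import Summits.ValiantsHypothesis.ValiantsHypothesis.Theorems.TwoProducts.Negative.RankTwoEscapes
import HarnessLib

/-!
# NEGATIVE lane (val-neg-1 g5): COMMON PADDING KIT — lemmas for `Negative/RankTwoPadding.lean`

Helper file for crux `stmt-ValiantsHypothesis-5906` (`TwoProducts`), filed `--supports`; it closes NO item, proves NO summit statement,
and does NOT prove `TwoProducts`, `PlanarCellBound` or VP ≠ VNP.  0 `def`s.  Contents (all [folklore]):
* the gadget binomial `X^{n s} + X^{2n s}` (`s ≠ 0`, `n ≠ 0`): constant term `0`, support `{n s, 2n s}` of size `≤ 2`;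
* COMMON padding `(Fin.append u w, Fin.append v w)`: `logDiff` / `logSupport` unchanged (`logDiff_append_common`), `tailSupport` and
  `ValidWeight` split over the two blocks (`tailSupport_append`, `validWeight_append_iff`), and the cell-family transfer
  `isCellFamily_append_common` for new letters that are valid-weight-negative, strictly below the old tail, and ordered by a fixed relation `Q`;
* DEEP exponents: `s = Σ_{e ∈ tailSupport u v} e` satisfies `wt ξ s ≤ wt ξ e < 0` for every valid `ξ` and tail letter `e`, hence
  `wt ξ (n • s) < wt ξ e` for `n ≥ 2` (`wt_nsmul_tailSum_lt`) and `wt ξ (n • s) ≤ wt ξ (n' • s) ↔ n' ≤ n` (`wt_nsmul_tailSum_le_iff`);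
* `planted_pair`: letters `n s, 2n s` at position `i` and `n s` at position `j ≠ i` give the equal-sum tuple pair `(2n s ∣ 0) ~ (n s ∣ n s)`
  with permutation types `{2n s}` ≠ `{n s, n s}`;
* `tailSupport_nonempty_of_isCellFamily`: a non-empty cell family forces a tail letter (else `logSupport = ∅`).
Landed facts used: `ClassCoverBound.{swap_at_i, swap_at_j, swap_of_ne, sum_swap}`, `TwoLetterEscape.msetT_swap`.  Axioms standard.
-/

namespace Summit.ValiantsHypothesis.Theorems.TwoProducts.Negative.CommonPadding

open Finset MvPolynomial
open Summit.ValiantsHypothesis.ValiantsHypothesis.Theorems.NewtonUnitEquations.TwoProducts.FormalLogLinearisation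
open Summit.ValiantsHypothesis.ValiantsHypothesis.Theorems.NewtonUnitEquations.TwoProducts.PlanarCell
open Summit.ValiantsHypothesis.ValiantsHypothesis.Theorems.NewtonUnitEquations.TwoProducts.PermutationType
  (msetT PermType RankOneCoincidences)
open Summit.ValiantsHypothesis.Theorems.TwoProducts.Negative.ClassCoverBound (swap_at_i swap_at_j swap_of_ne sum_swap)
open Summit.ValiantsHypothesis.Theorems.TwoProducts.Negative.TwoLetterEscape (msetT_swap)

variable {m k : ℕ}

/-! ### Scalar multiples of a non-zero exponent -/

/-- `n • s ≠ n' • s` for `s ≠ 0`, `n ≠ n'`. [folklore] -/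
theorem nsmul_ne_nsmul {s : Expo} (hs : s ≠ 0) {n n' : ℕ} (h : n ≠ n') : n • s ≠ n' • s := by
  obtain ⟨c, hc⟩ := Finsupp.ne_iff.mp hs
  intro he
  have := DFunLike.congr_fun he c
  simp only [Finsupp.smul_apply, smul_eq_mul, Finsupp.coe_zero, Pi.zero_apply] at this hc
  exact h (Nat.eq_of_mul_eq_mul_right (Nat.pos_of_ne_zero hc) this)

/-- `n • s ≠ 0` for `s ≠ 0`, `n ≠ 0`. [folklore] -/
theorem nsmul_ne_zero' {s : Expo} (hs : s ≠ 0) {n : ℕ} (h : n ≠ 0) : n • s ≠ 0 := by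
  have := nsmul_ne_nsmul hs h
  simpa using this

/-! ### The gadget binomial `X^{n•s} + X^{2n•s}` -/

/-- Constant term of the gadget vanishes. [folklore] -/
theorem coeff_zero_gadget {s : Expo} (hs : s ≠ 0) {n : ℕ} (hn : n ≠ 0) :
    coeff 0 ((monomial (n • s)) (1 : ℂ) + monomial ((2 * n) • s) 1) = 0 := by
  rw [coeff_add, coeff_monomial, coeff_monomial, if_neg (nsmul_ne_zero' hs hn), if_neg (nsmul_ne_zero' hs (by omega)),
    add_zero]

/-- The gadget has at most two support points. [folklore] -/
theorem card_support_gadget (s : Expo) (n : ℕ) :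
    ((monomial (n • s)) (1 : ℂ) + monomial ((2 * n) • s) 1).support.card ≤ 2 := by
  classical
  calc ((monomial (n • s)) (1 : ℂ) + monomial ((2 * n) • s) 1).support.card
      ≤ (((monomial (n • s)) (1 : ℂ)).support ∪ (monomial ((2 * n) • s) (1 : ℂ)).support).card :=
        Finset.card_le_card (support_add)
    _ ≤ ((monomial (n • s)) (1 : ℂ)).support.card + (monomial ((2 * n) • s) (1 : ℂ)).support.card := Finset.card_union_le _ _
    _ ≤ 1 + 1 := Nat.add_le_add (by rw [support_monomial, if_neg one_ne_zero]; simp)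
        (by rw [support_monomial, if_neg one_ne_zero]; simp)

/-- Support points of the gadget are `n • s` or `2n • s`. [folklore] -/
theorem mem_support_gadget {s : Expo} {n : ℕ} {e : Expo}
    (he : e ∈ ((monomial (n • s)) (1 : ℂ) + monomial ((2 * n) • s) 1).support) : e = n • s ∨ e = (2 * n) • s := by
  classical
  have := support_add he
  rw [Finset.mem_union, support_monomial, if_neg one_ne_zero, support_monomial, if_neg one_ne_zero,
    Finset.mem_singleton, Finset.mem_singleton] at this
  exact this

/-- Both gadget letters are support points. [folklore] -/
theorem nsmul_mem_support_gadget {s : Expo} (hs : s ≠ 0) {n : ℕ} (hn : n ≠ 0) :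
    n • s ∈ ((monomial (n • s)) (1 : ℂ) + monomial ((2 * n) • s) 1).support ∧
      (2 * n) • s ∈ ((monomial (n • s)) (1 : ℂ) + monomial ((2 * n) • s) 1).support := by
  have hne : n • s ≠ (2 * n) • s := nsmul_ne_nsmul hs (by omega)
  refine ⟨?_, ?_⟩ <;> rw [mem_support_iff, coeff_add, coeff_monomial, coeff_monomial]
  · rw [if_pos rfl, if_neg (Ne.symm hne)]; norm_num
  · rw [if_neg hne, if_pos rfl]; norm_num



/-! ### Common padding: the same new factors appended on both sides -/

/-- **The log-sum does not see common factors**: appending the SAME tuple of factors `w` to both sides leaves `logDiff`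
unchanged (the new `log(1 + w_i)` cancel termwise). [folklore] -/
theorem logDiff_append_common (u v : Fin m → MvPolynomial (Fin 2) ℂ) (w : Fin k → MvPolynomial (Fin 2) ℂ) (n : Expo) :
    logDiff (Fin.append u w) (Fin.append v w) n = logDiff u v n := by
  unfold logDiff
  rw [Fin.sum_univ_add, Fin.sum_univ_add]
  simp only [Fin.append_left, Fin.append_right]
  ring

/-- Hence the log-support is unchanged. [folklore] -/
theorem logSupport_append_common (u v : Fin m → MvPolynomial (Fin 2) ℂ) (w : Fin k → MvPolynomial (Fin 2) ℂ) :
    logSupport (Fin.append u w) (Fin.append v w) = logSupport u v := by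
  ext n
  simp only [logSupport, Set.mem_setOf_eq, logDiff_append_common]

/-- A `biUnion` over `Fin (m + k)` splits into the `castAdd` and the `natAdd` parts. [folklore] -/
theorem biUnion_univ_add (f : Fin (m + k) → Finset Expo) :
    (Finset.univ.biUnion f) = (Finset.univ.biUnion fun i : Fin m => f (Fin.castAdd k i)) ∪
      Finset.univ.biUnion fun i : Fin k => f (Fin.natAdd m i) := by
  ext e
  simp only [Finset.mem_biUnion, Finset.mem_univ, true_and, Finset.mem_union]
  constructor
  · rintro ⟨j, hj⟩
    induction j using Fin.addCases with
    | left i => exact Or.inl ⟨i, hj⟩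
    | right i => exact Or.inr ⟨i, hj⟩
  · rintro (⟨i, hi⟩ | ⟨i, hi⟩)
    · exact ⟨_, hi⟩
    · exact ⟨_, hi⟩

/-- **Tail support of an appended family** = old tail support ∪ tail support of the appended factors. [folklore] -/
theorem tailSupport_append (u v : Fin m → MvPolynomial (Fin 2) ℂ) (w w' : Fin k → MvPolynomial (Fin 2) ℂ) :
    tailSupport (Fin.append u w) (Fin.append v w') = tailSupport u v ∪ tailSupport w w' := by
  unfold tailSupport
  rw [biUnion_univ_add, biUnion_univ_add]
  simp only [Fin.append_left, Fin.append_right]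
  ext e
  simp only [Finset.mem_union]
  tauto

/-- **Valid weights of an appended family**: valid for the old family and negative on the new tails. [folklore] -/
theorem validWeight_append_iff (u v : Fin m → MvPolynomial (Fin 2) ℂ) (w w' : Fin k → MvPolynomial (Fin 2) ℂ)
    (ξ : Fin 2 → ℝ) :
    ValidWeight (Fin.append u w) (Fin.append v w') ξ ↔ ValidWeight u v ξ ∧ ValidWeight w w' ξ := by
  unfold ValidWeight
  rw [Fin.forall_fin_add, Fin.forall_fin_add]
  simp only [Fin.append_left, Fin.append_right]
  tauto

/-- Normalisation and sparsity of an appended family. [folklore] -/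
theorem norm_append {t : ℕ} (u : Fin m → MvPolynomial (Fin 2) ℂ) (w : Fin k → MvPolynomial (Fin 2) ℂ)
    (hu : ∀ j, coeff 0 (u j) = 0 ∧ (u j).support.card ≤ t) (hw : ∀ i, coeff 0 (w i) = 0 ∧ (w i).support.card ≤ t) :
    ∀ j, coeff 0 (Fin.append u w j) = 0 ∧ (Fin.append u w j).support.card ≤ t := by
  rw [Fin.forall_fin_add]
  simp only [Fin.append_left, Fin.append_right]
  exact ⟨hu, hw⟩

/-- **Cell families survive common DEEP padding.**  If the appended factors are common to both sides, every valid weight of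
the old family is negative on the new tails, every new tail letter lies STRICTLY BELOW every old tail letter for every valid
weight, and the new tail letters are ordered among themselves by a fixed relation `Q` for every valid weight, then every cell
family `S` of `(u, v)` (cell `R`) is a cell family of the padded instance, for the explicit cell `R'`. [folklore] -/
theorem isCellFamily_append_common (u v : Fin m → MvPolynomial (Fin 2) ℂ) (w : Fin k → MvPolynomial (Fin 2) ℂ)
    (Q : Expo → Expo → Prop)
    (hneg : ∀ ξ, ValidWeight u v ξ → ValidWeight w w ξ)
    (hdeep : ∀ ξ, ValidWeight u v ξ → ∀ e ∈ tailSupport u v, ∀ e' ∈ tailSupport w w, wt ξ e' < wt ξ e)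
    (hQ : ∀ ξ, ValidWeight u v ξ → ∀ e ∈ tailSupport w w, ∀ e' ∈ tailSupport w w, (Q e e' ↔ wt ξ e ≤ wt ξ e'))
    (R : Expo → Expo → Prop) (S : Finset Expo) (hS : IsCellFamily u v R S) :
    IsCellFamily (Fin.append u w) (Fin.append v w)
      (fun e e' => (e ∈ tailSupport u v → e' ∈ tailSupport u v ∧ R e e') ∧
        (e ∉ tailSupport u v → e' ∈ tailSupport u v ∨ Q e e')) S := by
  intro l hl
  obtain ⟨ξ, hval, htop, hR⟩ := hS l hl
  refine ⟨ξ, (validWeight_append_iff u v w w ξ).2 ⟨hval, hneg ξ hval⟩, ?_, ?_⟩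
  · rwa [logSupport_append_common]
  · intro e he e' he'
    rw [tailSupport_append, Finset.mem_union] at he he'
    by_cases heT : e ∈ tailSupport u v
    · by_cases heT' : e' ∈ tailSupport u v
      · -- old / old
        simp only [heT, heT', true_and, forall_true_left, not_true_eq_false, IsEmpty.forall_iff, and_true]
        exact hR e heT e' heT'
      · -- old / new : `e'` is strictly below `e`
        have he'N : e' ∈ tailSupport w w := he'.resolve_left heT'
        have hlt := hdeep ξ hval e heT e' he'N
        simp only [heT, heT', false_and, forall_true_left, not_true_eq_false, IsEmpty.forall_iff, and_true,
          false_iff, not_le]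
        exact hlt
    · have heN : e ∈ tailSupport w w := he.resolve_left heT
      by_cases heT' : e' ∈ tailSupport u v
      · -- new / old
        have hlt := hdeep ξ hval e' heT' e heN
        simp only [heT, heT', IsEmpty.forall_iff, not_false_eq_true, true_or, forall_true_left, and_self,
          true_iff]
        exact hlt.le
      · -- new / new
        have he'N : e' ∈ tailSupport w w := he'.resolve_left heT'
        simp only [heT, heT', IsEmpty.forall_iff, not_false_eq_true, false_or, forall_true_left, true_and]
        exact hQ ξ hval e heN e' he'N

/-! ### Deep exponents: the sum of all tail letters lies weakly below every tail letter, for every valid weight -/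

/-- Tail letters are negative for valid weights. [folklore] -/
theorem wt_neg_of_mem_tailSupport {u v : Fin m → MvPolynomial (Fin 2) ℂ} {ξ : Fin 2 → ℝ} (hval : ValidWeight u v ξ)
    {e : Expo} (he : e ∈ tailSupport u v) : wt ξ e < 0 := by
  unfold tailSupport at he
  simp only [Finset.mem_union, Finset.mem_biUnion, Finset.mem_univ, true_and] at he
  rcases he with ⟨j, hj⟩ | ⟨j, hj⟩
  · exact hval.1 j e hj
  · exact hval.2 j e hj

/-- The letter sum `s = Σ_{e ∈ T} e` lies weakly below every tail letter. [folklore] -/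
theorem wt_tailSum_le {u v : Fin m → MvPolynomial (Fin 2) ℂ} {ξ : Fin 2 → ℝ} (hval : ValidWeight u v ξ)
    {e : Expo} (he : e ∈ tailSupport u v) : wt ξ (∑ f ∈ tailSupport u v, f) ≤ wt ξ e := by
  rw [wt_sum, ← Finset.add_sum_erase _ _ he]
  have : ∑ f ∈ (tailSupport u v).erase e, wt ξ f ≤ 0 :=
    Finset.sum_nonpos fun f hf => (wt_neg_of_mem_tailSupport hval (Finset.mem_of_mem_erase hf)).le
  linarith

/-- The letter sum is negative as soon as there is a tail letter. [folklore] -/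
theorem wt_tailSum_neg {u v : Fin m → MvPolynomial (Fin 2) ℂ} {ξ : Fin 2 → ℝ} (hval : ValidWeight u v ξ)
    (hT : (tailSupport u v).Nonempty) : wt ξ (∑ f ∈ tailSupport u v, f) < 0 := by
  obtain ⟨e, he⟩ := hT
  exact (wt_tailSum_le hval he).trans_lt (wt_neg_of_mem_tailSupport hval he)

/-- Tail letters are non-zero (the factors are normalised: no constant term). [folklore] -/
theorem ne_zero_of_mem_tailSupport {u v : Fin m → MvPolynomial (Fin 2) ℂ} (hu : ∀ j, coeff 0 (u j) = 0)
    (hv : ∀ j, coeff 0 (v j) = 0) {e : Expo} (he : e ∈ tailSupport u v) : e ≠ 0 := by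
  rintro rfl
  unfold tailSupport at he
  simp only [Finset.mem_union, Finset.mem_biUnion, Finset.mem_univ, true_and, mem_support_iff] at he
  rcases he with ⟨j, hj⟩ | ⟨j, hj⟩
  · exact hj (hu j)
  · exact hj (hv j)

/-- The letter sum is non-zero as soon as there is a tail letter. [folklore] -/
theorem tailSum_ne_zero {u v : Fin m → MvPolynomial (Fin 2) ℂ} (hu : ∀ j, coeff 0 (u j) = 0) (hv : ∀ j, coeff 0 (v j) = 0)
    (hT : (tailSupport u v).Nonempty) : (∑ f ∈ tailSupport u v, f) ≠ 0 := by
  obtain ⟨e, he⟩ := hT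
  have he0 := ne_zero_of_mem_tailSupport hu hv he
  obtain ⟨c, hc⟩ := Finsupp.ne_iff.mp he0
  intro h0
  have h1 := DFunLike.congr_fun h0 c
  rw [Finsupp.finsetSum_apply, ← Finset.add_sum_erase _ _ he] at h1
  simp only [Finsupp.coe_zero, Pi.zero_apply] at h1 hc
  omega

/-- A multiple `n • s`, `n ≥ 2`, of the letter sum lies STRICTLY below every tail letter. [folklore] -/
theorem wt_nsmul_tailSum_lt {u v : Fin m → MvPolynomial (Fin 2) ℂ} {ξ : Fin 2 → ℝ} (hval : ValidWeight u v ξ)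
    {e : Expo} (he : e ∈ tailSupport u v) {n : ℕ} (hn : 2 ≤ n) :
    wt ξ (n • ∑ f ∈ tailSupport u v, f) < wt ξ e := by
  have hle := wt_tailSum_le hval he
  have hneg := wt_tailSum_neg hval ⟨e, he⟩
  rw [wt_nsmul]
  have hn' : (2 : ℝ) ≤ n := by exact_mod_cast hn
  nlinarith

/-- Multiples of the letter sum compare by their multipliers (reversed). [folklore] -/
theorem wt_nsmul_tailSum_le_iff {u v : Fin m → MvPolynomial (Fin 2) ℂ} {ξ : Fin 2 → ℝ} (hval : ValidWeight u v ξ)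
    (hT : (tailSupport u v).Nonempty) (n n' : ℕ) :
    wt ξ (n • ∑ f ∈ tailSupport u v, f) ≤ wt ξ (n' • ∑ f ∈ tailSupport u v, f) ↔ n' ≤ n := by
  have hneg := wt_tailSum_neg hval hT
  rw [wt_nsmul, wt_nsmul]
  constructor
  · intro h
    by_contra hlt
    push Not at hlt
    have : (n : ℝ) + 1 ≤ n' := by exact_mod_cast hlt
    nlinarith
  · intro h
    have : (n' : ℝ) ≤ n := by exact_mod_cast h
    nlinarith

/-! ### A letter tuple supported on two positions of an arbitrary family -/

/-- A swap tuple with entries in `A i ∪ {0}`, `A j ∪ {0}` is a letter tuple. [folklore] -/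
theorem swap_mem_tuples' {A : Fin m → Finset Expo} {i j : Fin m} (hij : i ≠ j) {x y : Expo}
    (hx : x ∈ insert (0 : Expo) (A i)) (hy : y ∈ insert (0 : Expo) (A j)) :
    (Pi.single i x + Pi.single j y : Fin m → Expo) ∈ tuples A := by
  unfold tuples
  rw [Fintype.mem_piFinset]
  intro l
  by_cases hi : l = i
  · subst hi; rwa [swap_at_i hij]
  · by_cases hj : l = j
    · subst hj; rwa [swap_at_j hij]
    · rw [swap_of_ne hi hj]; exact Finset.mem_insert_self _ _

/-! ### A planted torsion pair `X^{n s} + X^{2n s}` at two positions carries the coincidence `(2n s | 0) ~ (n s | n s)` -/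

/-- **One planted pair.**  If positions `i ≠ j` both carry the letters `n•s` and `2n•s` (`s ≠ 0`, `n ≠ 0`), the swap tuples
`a = (2n•s at i, 0 at j)` and `b = (n•s at i, n•s at j)` form a coincidence with different letter multisets, whose letter
multisets vanish outside `{n•s, 2n•s}`. [folklore] -/
theorem planted_pair {A : Fin m → Finset Expo} {i j : Fin m} (hij : i ≠ j) {s : Expo} (hs : s ≠ 0) {n : ℕ} (hn : n ≠ 0)
    (hi1 : n • s ∈ A i) (hi2 : (2 * n) • s ∈ A i) (hj1 : n • s ∈ A j) :
    (Pi.single i ((2 * n) • s) + Pi.single j (0 : Expo) : Fin m → Expo) ∈ tuples A ∧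
    (Pi.single i (n • s) + Pi.single j (n • s) : Fin m → Expo) ∈ tuples A ∧
    ∑ l, (Pi.single i ((2 * n) • s) + Pi.single j (0 : Expo) : Fin m → Expo) l =
      ∑ l, (Pi.single i (n • s) + Pi.single j (n • s) : Fin m → Expo) l ∧
    msetT (Pi.single i ((2 * n) • s) + Pi.single j (0 : Expo) : Fin m → Expo) = Finsupp.single ((2 * n) • s) 1 ∧
    msetT (Pi.single i (n • s) + Pi.single j (n • s) : Fin m → Expo) = Finsupp.single (n • s) 1 + Finsupp.single (n • s) 1 ∧
    msetT (Pi.single i ((2 * n) • s) + Pi.single j (0 : Expo) : Fin m → Expo) ≠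
      msetT (Pi.single i (n • s) + Pi.single j (n • s) : Fin m → Expo) := by
  have h2n0 : (2 * n) • s ≠ 0 := nsmul_ne_zero' hs (by omega)
  have hn0 : n • s ≠ 0 := nsmul_ne_zero' hs hn
  have hne : (2 * n) • s ≠ n • s := nsmul_ne_nsmul hs (by omega)
  have hPa : msetT (Pi.single i ((2 * n) • s) + Pi.single j (0 : Expo) : Fin m → Expo) = Finsupp.single ((2 * n) • s) 1 := by
    rw [msetT_swap hij, if_neg h2n0, if_pos rfl, add_zero]
  have hPb : msetT (Pi.single i (n • s) + Pi.single j (n • s) : Fin m → Expo) =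
      Finsupp.single (n • s) 1 + Finsupp.single (n • s) 1 := by
    rw [msetT_swap hij, if_neg hn0]
  refine ⟨swap_mem_tuples' hij (Finset.mem_insert_of_mem hi2) (Finset.mem_insert_self _ _),
    swap_mem_tuples' hij (Finset.mem_insert_of_mem hi1) (Finset.mem_insert_of_mem hj1), ?_, hPa, hPb, ?_⟩
  · rw [sum_swap, sum_swap, add_zero, mul_nsmul', two_nsmul]
  · rw [hPa, hPb]
    intro h
    have := DFunLike.congr_fun h ((2 * n) • s)
    simp [hne] at this

/-! ### Cell families force a tail letter -/

/-- The formal logarithm of the zero polynomial vanishes coefficientwise. [folklore] -/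
theorem logCoeff_zero_poly (n : Expo) : logCoeff (0 : MvPolynomial (Fin 2) ℂ) n = 0 := by
  unfold logCoeff
  refine Finset.sum_eq_zero fun r hr => ?_
  have hr1 : r ≠ 0 := by rw [Finset.mem_Icc] at hr; omega
  rw [zero_pow hr1, coeff_zero, mul_zero]

/-- Without tail letters the log-support is empty. [folklore] -/
theorem logSupport_eq_empty_of_tailSupport (u v : Fin m → MvPolynomial (Fin 2) ℂ) (hT : tailSupport u v = ∅) :
    logSupport u v = ∅ := by
  have hu : ∀ j, u j = 0 := by
    intro j
    rw [← support_eq_empty, ← Finset.subset_empty, ← hT]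
    intro e he
    unfold tailSupport
    exact Finset.mem_union_left _ (Finset.mem_biUnion.2 ⟨j, Finset.mem_univ _, he⟩)
  have hv : ∀ j, v j = 0 := by
    intro j
    rw [← support_eq_empty, ← Finset.subset_empty, ← hT]
    intro e he
    unfold tailSupport
    exact Finset.mem_union_right _ (Finset.mem_biUnion.2 ⟨j, Finset.mem_univ _, he⟩)
  ext n
  simp only [logSupport, logDiff, Set.mem_setOf_eq, Set.mem_empty_iff_false, iff_false, not_not, hu, hv,
    logCoeff_zero_poly, Finset.sum_const_zero, sub_zero]

/-- A non-empty cell family has a tail letter. [folklore] -/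
theorem tailSupport_nonempty_of_isCellFamily {u v : Fin m → MvPolynomial (Fin 2) ℂ} {R : Expo → Expo → Prop}
    {S : Finset Expo} (hS : IsCellFamily u v R S) (hne : S.Nonempty) : (tailSupport u v).Nonempty := by
  rw [Finset.nonempty_iff_ne_empty]
  intro hT
  obtain ⟨l, hl⟩ := hne
  obtain ⟨ξ, -, htop, -⟩ := hS l hl
  have := htop.1
  rw [logSupport_eq_empty_of_tailSupport u v hT] at this
  exact this

end Summit.ValiantsHypothesis.Theorems.TwoProducts.Negative.CommonPadding
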